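import Summits.CriticalPhenomena.Ising3DConformalLimit.Theorems.EnergyNotSigmaSquaredRungOneAdjacentMergingDefs
import Literature.Probability.LatticeModels.DirInvCorrLength
import HarnessLib

/-!
# Auxiliary lemmas for the stub `stub_assembly` of the line `dominant-shell-concentration`
# (crux `RungOneAdjacentMerging`, item stmt-CriticalPhenomena-11262, route `EnergyNotSigmaSquared`)

General helper lemmas for the assembly of the variance bound
(`Theorems/EnergyNotSigmaSquaredRungOneAdjacentMergingAssembly.lean`, which imports this file), split
off to respect the 400-line limit.  Contents (all elementary; the namespace and the objects `Gc`,
`e₂`, `axisG`, `Bub`, `dens`, `tstep`, `share`, `InfVolWeights`, `HasWindow` are those of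
`Theorems/EnergyNotSigmaSquaredRungOneAdjacentMergingDefs.lean`):
* the critical two-point function of `ℤ³`: positivity (`twoPointPlus_pos`, `criticalBeta_pos_holds`),
  evenness (`twoPointPlus_neg`), the Messager–Miracle-Solé sup-norm bound `G(z) ≤ g(n)` for
  `n ≤ ‖z‖_∞` (`twoPointPlus_le_axis_of_mem_sphere`, `twoPointPlus_add_single_le`), `B(L) > 0`,
  `‖e₂‖ = 1`, and one row of the bubble clumping sum `Σ_{v ∈ W} G(u-v)² ≤ B(L)`;
* elementary real inequalities: the CONE REDUCTION of the two-step density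
  (`asm_tstep_le`: `tstep x p q ≤ G(x)·X·dens x p·dens x q` once `G(q-p)/G(q) + G(p-q)/G(p) ≤ X`
  and `x` sees `p`, `q` in its toward-cone), the pair bound, the diagonal constant;
* bookkeeping identities for the cell-indexed weights `c(u) = Σ_k 1[u ∈ V_k] g_k(u)`
  (linearity / bilinearity of the first and second sums, the final double sum);
* the CROSS RATIOS lemma `asm_cross` (window regularity at the larger scale for the direct chain,
  MMS + decay separation for the reversed chain), Aizenman–Duminil-Copin 2021 §6.2, case `ℓ > k` of
  the proof of Prop. 6.6.
Helper names carry the prefix `asm_` (the namespace is shared with the other stub files of the line).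
No named fact is used; nothing is defined.
-/

noncomputable section

open Finset
open scoped BigOperators
open Literature.Probability.LatticeModels

namespace Summit.CriticalPhenomena.Ising3DConformalLimit.RungOneAdjacentMergingDominantShell

/-! ### Helper lemmas: the critical two-point function of `ℤ³` -/

/-- `G > 0` on `ℤ³` (`β_c(3) > 0`, Griffiths). -/
theorem asm_Gc_pos (z : Site 3) : 0 < Gc z :=
  twoPointPlus_pos (criticalBeta_pos_holds (d := 3) (by norm_num)) z

/-- Evenness: `G(u - v) = G(v - u)`. -/
theorem asm_Gc_sub_comm (u v : Site 3) : Gc (u - v) = Gc (v - u) := by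
  rw [← neg_sub v u]
  exact twoPointPlus_neg (criticalBeta 3) (v - u)

/-- `g(n) > 0`. -/
theorem asm_axisG_pos (n : ℕ) : 0 < axisG n :=
  asm_Gc_pos _

/-- Messager–Miracle-Solé in the sup norm: `G(z) ≤ g(n)` whenever `n ≤ ‖z‖_∞`. -/
theorem asm_Gc_le_axisG {z : Site 3} {n : ℕ} (h : n ≤ Site.supNorm z) : Gc z ≤ axisG n := by
  have hβ : (0 : ℝ) ≤ criticalBeta 3 := criticalBeta_nonneg 3
  have hMMS : ∀ {β : ℝ}, messager_miracleSole (d := 3) (β := β) := fun {β} =>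
    messager_miracleSole_holds (d := 3) (β := β)
  have h1 := twoPointPlus_le_axis_of_mem_sphere hMMS twoPointPlus_reflection_invariant_holds
    twoPointPlus_perm_invariant_holds hβ (show 1 ≤ 3 by norm_num) (self_mem_sphere z)
  have h2 := twoPointPlus_add_single_le hMMS hβ (Pi.single (⟨0, by norm_num⟩ : Fin 3) (n : ℤ))
    ⟨0, by norm_num⟩ (by simp) (Site.supNorm z - n)
  rw [← Pi.single_add] at h2
  have hcast : (n : ℤ) + ((Site.supNorm z - n : ℕ) : ℤ) = (Site.supNorm z : ℤ) := by omega
  rw [hcast] at h2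
  exact h1.trans h2

/-- `dens > 0`. -/
theorem asm_dens_pos (x u : Site 3) : 0 < dens x u :=
  div_pos (mul_pos (asm_Gc_pos u) (asm_Gc_pos (x - u))) (asm_Gc_pos x)

/-- `tstep ≥ 0`. -/
theorem asm_tstep_nonneg (x u v : Site 3) : 0 ≤ tstep x u v :=
  add_nonneg (mul_nonneg (mul_nonneg (asm_Gc_pos _).le (asm_Gc_pos _).le) (asm_Gc_pos _).le)
    (mul_nonneg (mul_nonneg (asm_Gc_pos _).le (asm_Gc_pos _).le) (asm_Gc_pos _).le)

/-- `B(L) > 0` for `L ≥ 0` (the origin contributes `G(0)² > 0`). -/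
theorem asm_Bub_pos {L : ℝ} (hL : 0 ≤ L) : 0 < Bub L :=
  (pow_pos (asm_Gc_pos 0) 2).trans_le (sq_apply_zero_le_bubbleDiagram (criticalTwoPoint 3) hL)

/-- `‖e₂‖ = 1`. -/
theorem asm_norm_e₂ : ‖e₂‖ = 1 := by
  rw [e₂, Pi.norm_single, norm_one]

/-- From a real lower bound on the norm to the integer sup norm. -/
theorem asm_le_supNorm {z : Site 3} {n : ℕ} (h : (n : ℝ) ≤ ‖z‖) : n ≤ Site.supNorm z := by
  rw [Site.norm_eq_supNorm] at h
  exact_mod_cast h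

/-- Points of norm at most `L` lie in the box `Λ_L`. -/
theorem asm_mem_latticeBox {z : Site 3} {L : ℝ} (h : ‖z‖ ≤ L) : z ∈ latticeBox 3 L :=
  mem_latticeBox.2 fun i => by
    rw [← Int.norm_eq_abs]
    exact (norm_le_pi_norm z i).trans h

/-- One row of the diagonal clumping sum: `Σ_{v ∈ W} G(u - v)² ≤ B(L)` if `‖u - v‖ ≤ L` on `W`
(injectivity of `v ↦ u - v`). -/
theorem asm_sum_sq_le_Bub (u : Site 3) (W : Finset (Site 3)) {L : ℝ}
    (hW : ∀ v ∈ W, ‖u - v‖ ≤ L) : ∑ v ∈ W, Gc (u - v) ^ 2 ≤ Bub L := by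
  have hinj : Set.InjOn (fun v => u - v) W := fun a _ b _ h => sub_right_injective h
  calc ∑ v ∈ W, Gc (u - v) ^ 2 = ∑ z ∈ W.image (fun v => u - v), Gc z ^ 2 := by
        rw [Finset.sum_image hinj]
    _ ≤ ∑ z ∈ latticeBox 3 L, Gc z ^ 2 := by
        refine Finset.sum_le_sum_of_subset_of_nonneg (fun z hz => ?_) fun _ _ _ => sq_nonneg _
        obtain ⟨v, hv, rfl⟩ := Finset.mem_image.1 hz
        exact asm_mem_latticeBox (hW v hv)
    _ = Bub L := rfl

/-! ### Helper lemmas: elementary real inequalities -/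

/-- Two ratio bounds add up. -/
theorem asm_ratio_add_le {a b c d X Y : ℝ} (hb : 0 < b) (hd : 0 < d) (h1 : a ≤ X * b)
    (h2 : c ≤ Y * d) : a / b + c / d ≤ X + Y :=
  add_le_add ((div_le_iff₀ hb).2 h1) ((div_le_iff₀ hd).2 h2)

/-- `(1 + t)² ≤ 1 + η/2` for `0 ≤ t ≤ η/8`, `η ≤ 16`. -/
theorem asm_sq_le {t η : ℝ} (ht0 : 0 ≤ t) (ht : t ≤ η / 8) (hη : η ≤ 16) :
    (1 + t) * (1 + t) ≤ 1 + η / 2 := by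
  nlinarith

/-- CONE REDUCTION of the two-step density: if `G(x) ≤ G(x - p)` and `G(x) ≤ G(x - q)` then
`tstep x p q ≤ G(x)·X·dens x p·dens x q` as soon as `G(q-p)/G(q) + G(p-q)/G(p) ≤ X`. -/
theorem asm_tstep_le : ∀ x p q : Site 3, Gc x ≤ Gc (x - p) → Gc x ≤ Gc (x - q) → ∀ X : ℝ,
    Gc (q - p) / Gc q + Gc (p - q) / Gc p ≤ X → tstep x p q ≤ Gc x * X * dens x p * dens x q := by
  intro x p q hxp hxq X hX
  have hG := asm_Gc_pos x
  have hp := asm_Gc_pos p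
  have hq := asm_Gc_pos q
  have hqp := asm_Gc_pos (q - p)
  have hpq := asm_Gc_pos (p - q)
  have hxp0 := asm_Gc_pos (x - p)
  have hxq0 := asm_Gc_pos (x - q)
  have hGne : Gc x ≠ 0 := hG.ne'
  have hpne : Gc p ≠ 0 := hp.ne'
  have hqne : Gc q ≠ 0 := hq.ne'
  have key : tstep x p q * Gc x ≤ X * (Gc p * Gc (x - p)) * (Gc q * Gc (x - q)) := by
    have hsum : (Gc (q - p) / Gc q + Gc (p - q) / Gc p) *
        ((Gc p * Gc (x - p)) * (Gc q * Gc (x - q))) =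
          Gc p * Gc (q - p) * Gc (x - q) * Gc (x - p) +
            Gc q * Gc (p - q) * Gc (x - p) * Gc (x - q) := by
      field_simp
    calc tstep x p q * Gc x
        = Gc p * Gc (q - p) * Gc (x - q) * Gc x + Gc q * Gc (p - q) * Gc (x - p) * Gc x := by
          rw [tstep]; ring
      _ ≤ Gc p * Gc (q - p) * Gc (x - q) * Gc (x - p) +
            Gc q * Gc (p - q) * Gc (x - p) * Gc (x - q) := by
          gcongr
      _ = (Gc (q - p) / Gc q + Gc (p - q) / Gc p) * ((Gc p * Gc (x - p)) * (Gc q * Gc (x - q))) :=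
          hsum.symm
      _ ≤ X * ((Gc p * Gc (x - p)) * (Gc q * Gc (x - q))) := by gcongr
      _ = X * (Gc p * Gc (x - p)) * (Gc q * Gc (x - q)) := by ring
  calc tstep x p q = tstep x p q * Gc x / Gc x := by rw [mul_div_cancel_right₀ _ hGne]
    _ ≤ X * (Gc p * Gc (x - p)) * (Gc q * Gc (x - q)) / Gc x := by gcongr
    _ = Gc x * X * dens x p * dens x q := by
        rw [dens, dens]
        field_simp

/-- PAIR BOUND: with `c_k(u) = s/(m·a·a')`, `c_ℓ(v) = t/(n·b·b')`, `T ≤ G X a b`,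
`T' ≤ G Y a' b'` and `X Y ≤ ρ`, the summand `c_k(u) c_ℓ(v) T T'` is at most `(s t/(m n))·G²·ρ`. -/
theorem asm_pair_le {s t m n a a' b b' T T' G X Y ρ : ℝ} (ha : 0 < a) (ha' : 0 < a')
    (hb : 0 < b) (hb' : 0 < b') (hm : 0 < m) (hn : 0 < n) (hs : 0 ≤ s) (ht : 0 ≤ t)
    (hT0 : 0 ≤ T) (hT'0 : 0 ≤ T') (hT : T ≤ G * X * a * b) (hT' : T' ≤ G * Y * a' * b')
    (hρ : X * Y ≤ ρ) :
    s / (m * (a * a')) * (t / (n * (b * b'))) * (T * T') ≤ s * t / (m * n) * G ^ 2 * ρ := by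
  have hD : 0 < a * a' * (b * b') := by positivity
  have h1 : T * T' ≤ (G * X * a * b) * (G * Y * a' * b') := mul_le_mul hT hT' hT'0 (hT0.trans hT)
  have h2 : (G * X * a * b) * (G * Y * a' * b') = G ^ 2 * (X * Y) * (a * a' * (b * b')) := by ring
  have h3 : G ^ 2 * (X * Y) * (a * a' * (b * b')) ≤ G ^ 2 * ρ * (a * a' * (b * b')) :=
    mul_le_mul_of_nonneg_right (mul_le_mul_of_nonneg_left hρ (sq_nonneg G)) hD.le
  have h4 : T * T' ≤ G ^ 2 * ρ * (a * a' * (b * b')) := h1.trans (h2.le.trans h3)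
  have hst : 0 ≤ s * t / (m * n) := by positivity
  have hm' : m ≠ 0 := hm.ne'
  have hn' : n ≠ 0 := hn.ne'
  have ha0 : a ≠ 0 := ha.ne'
  have ha0' : a' ≠ 0 := ha'.ne'
  have hb0 : b ≠ 0 := hb.ne'
  have hb0' : b' ≠ 0 := hb'.ne'
  calc s / (m * (a * a')) * (t / (n * (b * b'))) * (T * T')
      = s * t / (m * n) * ((T * T') / (a * a' * (b * b'))) := by
        field_simp
    _ ≤ s * t / (m * n) * (G ^ 2 * ρ) :=
        mul_le_mul_of_nonneg_left ((div_le_iff₀ hD).2 h4) hst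
    _ = s * t / (m * n) * G ^ 2 * ρ := by ring

/-- DIAGONAL CONSTANT: with `s = E α²/B` (the share), `c₀ E ≤ m` (the cell is large),
`(s/m)²·G²·(4/α²)·(m B) ≤ (4/c₀)·G²·s`. -/
theorem asm_diag_const {s m B α G E c₀ : ℝ} (hs : s = E * α ^ 2 / B) (hB : 0 < B) (hα : 0 < α)
    (hm : 0 < m) (hc₀ : 0 < c₀) (hE0 : 0 ≤ E) (hE : c₀ * E ≤ m) :
    s * s / (m * m) * G ^ 2 * (4 / α ^ 2) * (m * B) ≤ 4 / c₀ * G ^ 2 * s := by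
  have key : E / m ≤ 1 / c₀ := by
    rw [div_le_div_iff₀ hm hc₀]
    linarith
  have hm' : m ≠ 0 := hm.ne'
  have hB' : B ≠ 0 := hB.ne'
  have hα' : α ≠ 0 := hα.ne'
  have hc₀' : c₀ ≠ 0 := hc₀.ne'
  have e1 : s * s / (m * m) * G ^ 2 * (4 / α ^ 2) * (m * B) = (4 * G ^ 2 * s) * (E / m) := by
    rw [hs]
    field_simp
  have e2 : 4 / c₀ * G ^ 2 * s = (4 * G ^ 2 * s) * (1 / c₀) := by
    field_simp
  rw [e1, e2]
  refine mul_le_mul_of_nonneg_left key ?_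
  rw [hs]
  positivity

/-! ### Helper lemmas: bookkeeping of the cell-indexed sums -/

/-- Linearity: `Σ_{u ∈ U} (Σ_k 1[u ∈ V_k] g_k(u))·h(u) = Σ_k Σ_{u ∈ V_k} g_k(u) h(u)` when every
`V_k ⊆ U`. -/
theorem asm_sum_expand {α : Type*} [DecidableEq α] (U : Finset α) (𝒦 : Finset ℕ)
    (V : ℕ → Finset α) (hV : ∀ k ∈ 𝒦, V k ⊆ U) (g : ℕ → α → ℝ) (h : α → ℝ) :
    ∑ u ∈ U, (∑ k ∈ 𝒦, if u ∈ V k then g k u else 0) * h u =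
      ∑ k ∈ 𝒦, ∑ u ∈ V k, g k u * h u := by
  have hmul : ∀ u ∈ U, (∑ k ∈ 𝒦, if u ∈ V k then g k u else 0) * h u =
      ∑ k ∈ 𝒦, if u ∈ V k then g k u * h u else 0 := by
    intro u _
    rw [Finset.sum_mul]
    exact Finset.sum_congr rfl fun k _ => by split_ifs <;> simp
  rw [Finset.sum_congr rfl hmul, Finset.sum_comm]
  refine Finset.sum_congr rfl fun k hk => ?_
  rw [Finset.sum_ite_mem, Finset.inter_eq_right.2 (hV k hk)]

/-- Bilinearity: the double sum with the cell-indexed weights splits into blocks. -/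
theorem asm_sum_expand₂ {α : Type*} [DecidableEq α] (U : Finset α) (𝒦 : Finset ℕ)
    (V : ℕ → Finset α) (hV : ∀ k ∈ 𝒦, V k ⊆ U) (g : ℕ → α → ℝ) (F : α → α → ℝ) :
    ∑ u ∈ U, ∑ v ∈ U, (∑ k ∈ 𝒦, if u ∈ V k then g k u else 0) *
        (∑ k ∈ 𝒦, if v ∈ V k then g k v else 0) * F u v =
      ∑ k ∈ 𝒦, ∑ ℓ ∈ 𝒦, ∑ u ∈ V k, ∑ v ∈ V ℓ, g k u * g ℓ v * F u v := by
  calc ∑ u ∈ U, ∑ v ∈ U, (∑ k ∈ 𝒦, if u ∈ V k then g k u else 0) *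
        (∑ k ∈ 𝒦, if v ∈ V k then g k v else 0) * F u v
      = ∑ u ∈ U, (∑ k ∈ 𝒦, if u ∈ V k then g k u else 0) *
          ∑ v ∈ U, (∑ k ∈ 𝒦, if v ∈ V k then g k v else 0) * F u v := by
        refine Finset.sum_congr rfl fun u _ => ?_
        rw [Finset.mul_sum]
        exact Finset.sum_congr rfl fun v _ => by ring
    _ = ∑ k ∈ 𝒦, ∑ u ∈ V k, g k u *
          ∑ v ∈ U, (∑ k ∈ 𝒦, if v ∈ V k then g k v else 0) * F u v :=
        asm_sum_expand U 𝒦 V hV g _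
    _ = ∑ k ∈ 𝒦, ∑ u ∈ V k, g k u * ∑ ℓ ∈ 𝒦, ∑ v ∈ V ℓ, g ℓ v * F u v := by
        refine Finset.sum_congr rfl fun k _ => Finset.sum_congr rfl fun u _ => ?_
        rw [asm_sum_expand U 𝒦 V hV g (F u)]
    _ = ∑ k ∈ 𝒦, ∑ u ∈ V k, ∑ ℓ ∈ 𝒦, ∑ v ∈ V ℓ, g k u * g ℓ v * F u v := by
        refine Finset.sum_congr rfl fun k _ => Finset.sum_congr rfl fun u _ => ?_
        rw [Finset.mul_sum]
        refine Finset.sum_congr rfl fun ℓ _ => ?_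
        rw [Finset.mul_sum]
        exact Finset.sum_congr rfl fun v _ => by ring
    _ = ∑ k ∈ 𝒦, ∑ ℓ ∈ 𝒦, ∑ u ∈ V k, ∑ v ∈ V ℓ, g k u * g ℓ v * F u v :=
        Finset.sum_congr rfl fun k _ => Finset.sum_comm

/-- Summing the block bounds: `Σ_{k,ℓ} (s_k s_ℓ Q + 1[k=ℓ] D s_k) = (Σ s)² Q + D Σ s`. -/
theorem asm_double_sum_eq (𝒦 : Finset ℕ) (s : ℕ → ℝ) (Q D : ℝ) :
    ∑ k ∈ 𝒦, ∑ ℓ ∈ 𝒦, (s k * s ℓ * Q + if k = ℓ then D * s k else 0) =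
      (∑ k ∈ 𝒦, s k) * (∑ k ∈ 𝒦, s k) * Q + D * ∑ k ∈ 𝒦, s k := by
  simp_rw [Finset.sum_add_distrib]
  rw [Finset.sum_mul_sum, Finset.sum_mul, Finset.mul_sum]
  congr 1
  · exact Finset.sum_congr rfl fun k _ => by rw [Finset.sum_mul]
  · exact Finset.sum_congr rfl fun k hk => by rw [Finset.sum_ite_eq, if_pos hk]

/-- `InfVolWeights` is monotone in the level `η`. -/
theorem asm_infVolWeights_mono {η η' : ℝ} (h : η ≤ η') {x : Site 3} (hx : InfVolWeights η x) :
    InfVolWeights η' x := by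
  obtain ⟨U, c, hc, hpos, hle⟩ := hx
  refine ⟨U, c, hc, hpos, hle.trans ?_⟩
  gcongr

/-! ### The geometric inputs of the cross terms -/

/-- CROSS RATIOS.  For a small-scale point `p` (`‖p‖ ≤ 2^k`, `G(p), G(p-e₂) ≥ g(2^{k+2})`) and a
large-scale point `q` (`2^{ℓ-1} ≤ ‖q‖ ≤ 2^ℓ`, `ℓ ≥ 4` windowed) at decay/index separated scales
(`g(2^{ℓ-2}) ≤ τ g(2^{k+2})`, `2^{k+1} ≤ τ 2^ℓ`, `τ ≤ 1/16`): the direct chain costs `1 + Cτ` (window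
regularity at scale `ℓ`, for `q` and for `q - e₂`) and the reversed chain costs `τ` (MMS + separation). -/
theorem asm_cross {A C τ : ℝ} (hC0 : 0 ≤ C) (hτ0 : 0 ≤ τ) (hτ16 : τ ≤ 1 / 16)
    (hW : ∀ ℓ : ℕ, 4 ≤ ℓ → HasWindow A ℓ → ∀ v w : Site 3, (2 : ℝ) ^ (ℓ - 2) ≤ ‖v‖ →
      ‖v‖ ≤ (2 : ℝ) ^ (ℓ + 1) → 16 * ‖w‖ ≤ (2 : ℝ) ^ ℓ →
      Gc (v - w) ≤ (1 + C * ‖w‖ / 2 ^ ℓ) * Gc v)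
    {k ℓ : ℕ} (hℓ4 : 4 ≤ ℓ) (hwin : HasWindow A ℓ)
    (hsep : axisG (2 ^ (ℓ - 2)) ≤ τ * axisG (2 ^ (k + 2))) (hidx : (2 : ℝ) ^ (k + 1) ≤ τ * 2 ^ ℓ)
    {p q : Site 3} (hp : ‖p‖ ≤ (2 : ℝ) ^ k) (hq1 : (2 : ℝ) ^ (ℓ - 1) ≤ ‖q‖)
    (hq2 : ‖q‖ ≤ (2 : ℝ) ^ ℓ) (hpa : axisG (2 ^ (k + 2)) ≤ Gc p)
    (hpa' : axisG (2 ^ (k + 2)) ≤ Gc (p - e₂)) :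
    Gc (q - p) ≤ (1 + C * τ) * Gc q ∧ Gc (q - p) ≤ (1 + C * τ) * Gc (q - e₂) ∧
      Gc (p - q) ≤ τ * Gc p ∧ Gc (p - q) ≤ τ * Gc (p - e₂) := by
  -- dyadic bookkeeping: everything in terms of `P = 2^(ℓ-2)` and `K = 2^k`
  have h2 : (2 : ℝ) ^ ℓ = 4 * 2 ^ (ℓ - 2) := by
    obtain ⟨m, rfl⟩ : ∃ m, ℓ = m + 2 := ⟨ℓ - 2, by omega⟩
    rw [Nat.add_sub_cancel, pow_add]
    ring
  have h1 : (2 : ℝ) ^ (ℓ - 1) = 2 * 2 ^ (ℓ - 2) := by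
    obtain ⟨m, rfl⟩ : ∃ m, ℓ = m + 2 := ⟨ℓ - 2, by omega⟩
    rw [Nat.add_sub_cancel, show m + 2 - 1 = m + 1 by omega, pow_succ]
    ring
  have h3 : (2 : ℝ) ^ (ℓ + 1) = 8 * 2 ^ (ℓ - 2) := by
    rw [pow_succ, h2]
    ring
  have hP1 : (1 : ℝ) ≤ 2 ^ (ℓ - 2) := one_le_pow₀ (by norm_num)
  have hK1 : (1 : ℝ) ≤ 2 ^ k := one_le_pow₀ (by norm_num)
  have h2ℓ : (0 : ℝ) < 2 ^ ℓ := by positivity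
  rw [h1] at hq1
  have hq2' : ‖q‖ ≤ 4 * 2 ^ (ℓ - 2) := h2 ▸ hq2
  have hidx' : 2 * (2 : ℝ) ^ k ≤ τ * (4 * 2 ^ (ℓ - 2)) := by
    rw [← h2, ← pow_succ']
    exact hidx
  have hKP : 8 * (2 : ℝ) ^ k ≤ 2 ^ (ℓ - 2) := by
    have := mul_le_mul_of_nonneg_right hτ16 (by positivity : (0 : ℝ) ≤ 4 * 2 ^ (ℓ - 2))
    linarith
  have he := asm_norm_e₂
  have hpe : ‖p - e₂‖ ≤ 2 ^ k + 1 := by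
    have := norm_sub_le p e₂
    rw [he] at this
    linarith
  have hqe1 : (2 : ℝ) ^ (ℓ - 2) ≤ ‖q - e₂‖ := by
    have := norm_sub_norm_le q e₂
    rw [he] at this
    linarith
  have hqe2 : ‖q - e₂‖ ≤ (2 : ℝ) ^ (ℓ + 1) := by
    have := norm_sub_le q e₂
    rw [he] at this
    rw [h3]
    linarith
  have hpq : (2 : ℝ) ^ (ℓ - 2) ≤ ‖p - q‖ := by
    have := norm_sub_norm_le q p
    rw [norm_sub_rev] at this
    linarith
  -- the two window instances (at the larger scale `ℓ`)
  have W1 := hW ℓ hℓ4 hwin q p (by linarith) (by rw [h3]; linarith) (by rw [h2]; linarith)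
  have W2 := hW ℓ hℓ4 hwin (q - e₂) (p - e₂) hqe1 hqe2 (by rw [h2]; linarith)
  rw [sub_sub_sub_cancel_right] at W2
  have hfac : ∀ w : Site 3, ‖w‖ ≤ 2 ^ k + 1 → 1 + C * ‖w‖ / 2 ^ ℓ ≤ 1 + C * τ := by
    intro w hw
    have hw' : ‖w‖ ≤ τ * 2 ^ ℓ := by
      rw [h2]
      linarith
    have : C * ‖w‖ / 2 ^ ℓ ≤ C * τ := by
      rw [div_le_iff₀ h2ℓ]
      calc C * ‖w‖ ≤ C * (τ * 2 ^ ℓ) := mul_le_mul_of_nonneg_left hw' hC0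
        _ = C * τ * 2 ^ ℓ := by ring
    linarith
  -- the reversed chain: MMS numerator and decay separation
  have hnum : Gc (p - q) ≤ τ * axisG (2 ^ (k + 2)) := by
    refine (asm_Gc_le_axisG (asm_le_supNorm ?_)).trans hsep
    push_cast
    exact hpq
  exact ⟨W1.trans (mul_le_mul_of_nonneg_right (hfac p (by linarith)) (asm_Gc_pos q).le),
    W2.trans (mul_le_mul_of_nonneg_right (hfac (p - e₂) hpe) (asm_Gc_pos _).le),
    hnum.trans (mul_le_mul_of_nonneg_left hpa hτ0),
    hnum.trans (mul_le_mul_of_nonneg_left hpa' hτ0)⟩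

end Summit.CriticalPhenomena.Ising3DConformalLimit.RungOneAdjacentMergingDominantShell

end
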